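import Mathlib
import HarnessLib
import Literature.Computability.AlgebraicComplexity.AsymptoticSpectrum
import Literature.Computability.AlgebraicComplexity.QuantumFunctionals
import Literature.Computability.AlgebraicComplexity.DegenerationSpectralMonotone
import Literature.Barriers.MatrixMultiplication.UniversalMethodBarrier
import Summits.MatrixMultiplication.MatrixMultiplication.Theorems.SoloInformedConverseDoorLimit
import Summits.MatrixMultiplication.MatrixMultiplication.Theorems.OutsiderSandwichMinrankGap
import Summits.MatrixMultiplication.MatrixMultiplication.Theorems.OutsiderSandwichRestrictionGap

/-!
# OutsiderSandwich — the BCS bridge: algebraic degeneration (`⊴` over `ℂ[ε]`) implies orbit-closure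
degeneration; no rung `p/q`, `p < q`, is a degeneration of ANY order at any finite level
(lens-4 g33, K33-C; settles handoff P32-a of NODE-g32)

Route-independent support kernel (no `Theses` import, no new definitions).

The tree carries two degeneration notions for 3-tensors: the ALGEBRAIC one over `ℂ[ε]`,
`AlgDegeneratesTo s t` (`DegenerationSpectralMonotone`: `(A(ε) ⊗ B(ε) ⊗ C(ε))·s = ε^h t + O(ε^{h+1})`,
BCS (15.19); Alman's transposed convention `PolyDegeneratesTo` of the universal-method barrier), in which
the degenerations of the literature are constructed, and the TOPOLOGICAL one `TensorDegeneratesTo s t`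
(`t ∈ cl(GL³·s)`, CVZ Rem. 1.2), in which the Kempf–Ness obstructions of this lineage are proved
(`OutsiderSandwichNoPerfectDegeneration`, `OutsiderSandwichMinrankGap`).  §2 proves the standard bridge
for equal formats (BCS (15.23)/Strassen 1987: substitute a small complex number for `ε` and divide by
`ε^h`): each `ε^{-h}·(A(ε) ⊗ B(ε) ⊗ C(ε))·s`, `ε ∈ ℂˣ`, is a RESTRICTION of `s`, hence in the orbit closure
(`OutsiderSandwichRestrictionGap.tensorDegeneratesTo_of_restrictsTo`), and these tend to `t` as `ε → 0`.
§3: consequently `⟨n⟩ ⊠ cw₂^{⊠N} ⋭ ⟨n'⟩ ⊠ ⟨m,m,m⟩` in the BCS sense — no degeneration of any order `h` —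
whenever the formats agree and `m < 2^N`; in particular no exchange rung `p/q` (`p < q`) of the g31/g32
ladder is a finite-order degeneration at any level, and the first open rung `1/2` is not one at level one
(`⟨4⟩ ⊠ cw₂^{⊠2} ⋭ ⟨9⟩ ⊠ ⟨2,2,2⟩`).  The rungs are intrinsically asymptotic (`o(L)` orders / slack needed).

References: [cite: BurgisserClausenShokrollahi1997, (15.19), (15.23), Lemma 15.24];
[cite: ChristandlVranaZuiddam2023, Rem. 1.2]; [cite: Alman2021, §2.4]; [cite: KempfNess1979, Thm. 0.2];
[cite: BlaserIkenmeyerLysikovPandeySchreyer2019, Lemma 18].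
-/

noncomputable section

open scoped BigOperators Matrix Topology Polynomial
open Filter Polynomial

open Literature.Computability.AlgebraicComplexity
open Literature.Barriers.MatrixMultiplication

namespace Summit.MatrixMultiplication.MatrixMultiplication.Theorems.OutsiderSandwichDegenerationBridge

open OutsiderSandwichMinrankGap OutsiderSandwichRestrictionGap

/-! ## §1  Two lemmas: a polynomial divisible by `X^h`, rescaled; scalars in `actTensor` -/

section Lemmas

/-- If `P ∈ ℂ[X]` has vanishing coefficients below degree `h` and coefficient `v` in degree `h`, then
`z^{-h} P(z) → v` as `z → 0`, `z ≠ 0` (write `P = X^h Q`, `Q(0) = v`). [folklore] -/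
theorem tendsto_inv_pow_mul_eval {P : ℂ[X]} {h : ℕ} {v : ℂ} (hlow : ∀ j < h, P.coeff j = 0)
    (hh : P.coeff h = v) :
    Tendsto (fun z : ℂ => (z ^ h)⁻¹ * P.eval z) (𝓝[≠] 0) (𝓝 v) := by
  obtain ⟨Q, hQ⟩ := Polynomial.X_pow_dvd_iff.2 hlow
  have hQ0 : Q.eval 0 = v := by
    rw [← Polynomial.coeff_zero_eq_eval_zero, ← hh, hQ]
    simpa using (Polynomial.coeff_X_pow_mul Q h 0).symm
  have hQt : Tendsto (fun z : ℂ => Q.eval z) (𝓝[≠] 0) (𝓝 v) := by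
    rw [← hQ0]
    exact (Q.continuousAt.tendsto).mono_left nhdsWithin_le_nhds
  refine hQt.congr' (eventually_nhdsWithin_of_forall fun z hz => ?_)
  have hz' : (z : ℂ) ^ h ≠ 0 := pow_ne_zero h hz
  show Q.eval z = (z ^ h)⁻¹ * P.eval z
  rw [hQ, Polynomial.eval_mul, Polynomial.eval_pow, Polynomial.eval_X, inv_mul_cancel_left₀ hz']

end Lemmas

/-! ## §2  The bridge `AlgDegeneratesTo ⟹ TensorDegeneratesTo` (equal formats, over `ℂ`) -/

section Bridge

variable {ι κ μ : Type*} [Fintype ι] [Fintype κ] [Fintype μ]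
  [DecidableEq ι] [DecidableEq κ] [DecidableEq μ]

/-- **A degeneration of order `h` is an orbit-closure degeneration** (equal formats, over `ℂ`): if
`(A(ε) ⊗ B(ε) ⊗ C(ε))·s = ε^h t + O(ε^{h+1})`, then `t = lim_{z→0, z≠0} z^{-h}·(A(z) ⊗ B(z) ⊗ C(z))·s` is a
limit of restrictions of `s`, each of which lies in `cl(GL³·s)`. [cite: BurgisserClausenShokrollahi1997,
(15.23)] [cite: ChristandlVranaZuiddam2023, Rem. 1.2] -/
theorem tensorDegeneratesTo_of_isApproxRestriction {h : ℕ} {s t : ι → κ → μ → ℂ}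
    {A : ι → ι → ℂ[X]} {B : κ → κ → ℂ[X]} {C : μ → μ → ℂ[X]}
    (hR : IsApproxRestriction h s t A B C) : TensorDegeneratesTo s t := by
  set g : ℂ → (ι → κ → μ → ℂ) := fun z =>
    actTensor ((z ^ h)⁻¹ • fun a' a => (A a' a).eval z) (fun b' b => (B b' b).eval z)
      (fun c' c => (C c' c).eval z) s with hg_def
  have hmem : ∀ z, TensorDegeneratesTo s (g z) := fun z =>
    tensorDegeneratesTo_of_restrictsTo ((tensorRestrictsTo_iff_exists_actTensor s _).2 ⟨_, _, _, rfl⟩)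
  have hlim : Tendsto g (𝓝[≠] 0) (𝓝 t) := by
    rw [tendsto_pi_nhds]; intro a'
    rw [tendsto_pi_nhds]; intro b'
    rw [tendsto_pi_nhds]; intro c'
    have hP := hR a' b' c'
    have hg : ∀ z, g z a' b' c' = (z ^ h)⁻¹ *
        (∑ a, ∑ b, ∑ c, A a' a * B b' b * C c' c * Polynomial.C (s a b c)).eval z := by
      intro z
      simp only [hg_def, actTensor_apply, Polynomial.eval_finsetSum, Polynomial.eval_mul,
        Polynomial.eval_C, Pi.smul_apply, smul_eq_mul, Finset.mul_sum]
      refine Finset.sum_congr rfl fun a _ => Finset.sum_congr rfl fun b _ =>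
        Finset.sum_congr rfl fun c _ => ?_
      ring
    simp_rw [hg]
    exact tendsto_inv_pow_mul_eval (fun j hj => by simpa [hj.ne] using hP j hj.le)
      (by simpa using hP h le_rfl)
  haveI : NeBot (𝓝[≠] (0 : ℂ)) := NormedField.nhdsNE_neBot 0
  unfold TensorDegeneratesTo at hmem ⊢
  exact isClosed_closure.mem_of_tendsto hlim (Eventually.of_forall hmem)

/-- **`t ⊴ s ⟹ s ⊵ t`**: an algebraic degeneration over `ℂ[ε]` between tensors of one format is an
orbit-closure degeneration. [cite: BurgisserClausenShokrollahi1997, (15.23)]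
[cite: ChristandlVranaZuiddam2023, Rem. 1.2] -/
theorem tensorDegeneratesTo_of_algDegeneratesTo {s t : ι → κ → μ → ℂ} (h : AlgDegeneratesTo s t) :
    TensorDegeneratesTo s t := by
  obtain ⟨h, A, B, C, hR⟩ := h
  exact tensorDegeneratesTo_of_isApproxRestriction hR

/-- Contrapositive with a relabelled target: if `s ⋭ e^* t` topologically then `t` is not an algebraic
degeneration of `s` (any order, BCS sense). [cite: BurgisserClausenShokrollahi1997, (15.25)] -/
theorem not_algDegeneratesTo_of_not_degeneratesTo_relabel {ι' : Type*} [Fintype ι'] [DecidableEq ι']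
    {s : ι → ι → ι → ℂ} {t : ι' → ι' → ι' → ℂ} (e : ι ≃ ι')
    (h : ¬ TensorDegeneratesTo s (fun a b c => t (e a) (e b) (e c))) : ¬ AlgDegeneratesTo s t := by
  intro hst
  refine h (tensorDegeneratesTo_of_algDegeneratesTo (hst.trans_restrictsTo ?_))
  exact tensorRestrictsTo_relabel e (TensorRestrictsTo.refl t)

end Bridge

/-! ## §3  No rung is a finite-order degeneration -/

section Rungs

/-- **No finite-order degeneration** `⟨n⟩ ⊠ cw₂^{⊠N} ⊵ ⟨n'⟩ ⊠ ⟨m,m,m⟩` (BCS `⊴_h`, any `h`) when the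
formats agree (`n·3^N = n'·m²`) and `m < 2^N`. [cite: BurgisserClausenShokrollahi1997, (15.19)]
[cite: KempfNess1979, Thm. 0.2] [cite: BlaserIkenmeyerLysikovPandeySchreyer2019, Lemma 18] -/
theorem unitKronecker_cwTwoPow_not_algDegeneratesTo_matMul {n N n' m : ℕ} (hn' : 0 < n') (hm : 0 < m)
    (hmN : m < 2 ^ N) (hfmt : n * 3 ^ N = n' * (m * m)) :
    ¬ AlgDegeneratesTo (kroneckerTensor (unitTensor ℂ n) (kroneckerPow (cwTensor ℂ 2) N))
      (kroneckerTensor (unitTensor ℂ n') (matMulTensor ℂ m m m)) := by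
  have hcard : Fintype.card (Fin n × (Fin N → Fin 3)) = Fintype.card (Fin n' × (Fin m × Fin m)) := by
    simp only [Fintype.card_prod, Fintype.card_fun, Fintype.card_fin]
    exact hfmt
  exact not_algDegeneratesTo_of_not_degeneratesTo_relabel (Fintype.equivOfCardEq hcard)
    (unitKronecker_cwTwoPow_not_degeneratesTo_matMul hn' hm hmN (Fintype.equivOfCardEq hcard))

/-- The same in Alman's convention (`PolyDegeneratesTo`, the degeneration of the universal-method
barrier). [cite: Alman2021, §2.4] [cite: KempfNess1979, Thm. 0.2] -/
theorem unitKronecker_cwTwoPow_not_polyDegeneratesTo_matMul {n N n' m : ℕ} (hn' : 0 < n') (hm : 0 < m)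
    (hmN : m < 2 ^ N) (hfmt : n * 3 ^ N = n' * (m * m)) :
    ¬ PolyDegeneratesTo (kroneckerTensor (unitTensor ℂ n) (kroneckerPow (cwTensor ℂ 2) N))
      (kroneckerTensor (unitTensor ℂ n') (matMulTensor ℂ m m m)) :=
  fun h => unitKronecker_cwTwoPow_not_algDegeneratesTo_matMul hn' hm hmN hfmt
    (ConverseDoorLimit.algDegeneratesTo_of_polyDegeneratesTo h)

/-- **No exchange rung `p/q` with `p < q` is a degeneration of any order at any finite level**: for every
`L ≥ 1`, `⟨3^{qL}⟩ ⊠ ⟨2^{pL}, 2^{pL}, 2^{pL}⟩ ⋬ ⟨4^{pL}⟩ ⊠ cw₂^{⊠ qL}` over `ℂ[ε]`.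
[cite: BurgisserClausenShokrollahi1997, (15.19)] [cite: Strassen1988, Thm. 3.8] [cite: KempfNess1979, Thm. 0.2] -/
theorem rung_not_algDegeneratesTo_of_lt {p q L : ℕ} (hpq : p < q) (hL : 0 < L) :
    ¬ AlgDegeneratesTo
        (kroneckerTensor (unitTensor ℂ (4 ^ (p * L))) (kroneckerPow (cwTensor ℂ 2) (q * L)))
        (kroneckerTensor (unitTensor ℂ (3 ^ (q * L)))
          (matMulTensor ℂ (2 ^ (p * L)) (2 ^ (p * L)) (2 ^ (p * L)))) := by
  refine unitKronecker_cwTwoPow_not_algDegeneratesTo_matMul (by positivity) (by positivity)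
    (Nat.pow_lt_pow_right (by norm_num) (Nat.mul_lt_mul_of_pos_right hpq hL)) ?_
  rw [← pow_add, show (4 : ℕ) = 2 ^ 2 by norm_num, ← pow_mul, mul_comm (3 ^ (q * L))]
  congr 1
  ring_nf

/-- **The first open rung `1/2` is not a degeneration of any order at level one**:
`⟨9⟩ ⊠ ⟨2,2,2⟩ ⋬ ⟨4⟩ ⊠ cw₂^{⊠2}` over `ℂ[ε]` (format `36`). [cite: KempfNess1979, Thm. 0.2]
[cite: BurgisserClausenShokrollahi1997, (15.19)] -/
theorem rungHalf_not_algDegeneratesTo_levelOne :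
    ¬ AlgDegeneratesTo (kroneckerTensor (unitTensor ℂ 4) (kroneckerPow (cwTensor ℂ 2) 2))
      (kroneckerTensor (unitTensor ℂ 9) (matMulTensor ℂ 2 2 2)) :=
  unitKronecker_cwTwoPow_not_algDegeneratesTo_matMul (by norm_num) (by norm_num) (by norm_num)
    (by norm_num)

/-- Rung `1/2` is not a degeneration of any order at level two: `⟨81⟩ ⊠ ⟨4,4,4⟩ ⋬ ⟨16⟩ ⊠ cw₂^{⊠4}`
(format `1296`). [cite: KempfNess1979, Thm. 0.2] -/
theorem rungHalf_not_algDegeneratesTo_levelTwo :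
    ¬ AlgDegeneratesTo (kroneckerTensor (unitTensor ℂ 16) (kroneckerPow (cwTensor ℂ 2) 4))
      (kroneckerTensor (unitTensor ℂ 81) (matMulTensor ℂ 4 4 4)) :=
  unitKronecker_cwTwoPow_not_algDegeneratesTo_matMul (by norm_num) (by norm_num) (by norm_num)
    (by norm_num)

/-- Rung `1/3` at level one: `⟨27⟩ ⊠ ⟨2,2,2⟩ ⋬ ⟨4⟩ ⊠ cw₂^{⊠3}` (format `108`). [cite: KempfNess1979, Thm. 0.2] -/
theorem rungThird_not_algDegeneratesTo_levelOne :
    ¬ AlgDegeneratesTo (kroneckerTensor (unitTensor ℂ 4) (kroneckerPow (cwTensor ℂ 2) 3))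
      (kroneckerTensor (unitTensor ℂ 27) (matMulTensor ℂ 2 2 2)) :=
  unitKronecker_cwTwoPow_not_algDegeneratesTo_matMul (by norm_num) (by norm_num) (by norm_num)
    (by norm_num)

/-- Rung `2/3` at level one: `⟨27⟩ ⊠ ⟨4,4,4⟩ ⋬ ⟨16⟩ ⊠ cw₂^{⊠3}` (format `432`). [cite: KempfNess1979, Thm. 0.2] -/
theorem rungTwoThirds_not_algDegeneratesTo_levelOne :
    ¬ AlgDegeneratesTo (kroneckerTensor (unitTensor ℂ 16) (kroneckerPow (cwTensor ℂ 2) 3))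
      (kroneckerTensor (unitTensor ℂ 27) (matMulTensor ℂ 4 4 4)) :=
  unitKronecker_cwTwoPow_not_algDegeneratesTo_matMul (by norm_num) (by norm_num) (by norm_num)
    (by norm_num)

/-- The unit-packed perfection cells over `ℂ[ε]`: `⟨1⟩ ⊠ cw₂^{⊠N} ⋭ ⟨1⟩ ⊠ ⟨m,m,m⟩` (any order) whenever
`m² = 3^N`, `N ≥ 1`. [cite: KempfNess1979, Thm. 0.2] [cite: BurgisserClausenShokrollahi1997, (15.19)] -/
theorem cell_not_algDegeneratesTo_of_sq_eq {N m : ℕ} (h : m * m = 3 ^ N) (hN : 1 ≤ N) :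
    ¬ AlgDegeneratesTo (kroneckerTensor (unitTensor ℂ 1) (kroneckerPow (cwTensor ℂ 2) N))
      (kroneckerTensor (unitTensor ℂ 1) (matMulTensor ℂ m m m)) := by
  have hcard : Fintype.card (Fin 1 × (Fin N → Fin 3)) = Fintype.card (Fin 1 × (Fin m × Fin m)) := by
    simp only [Fintype.card_prod, Fintype.card_fun, Fintype.card_fin]
    omega
  exact not_algDegeneratesTo_of_not_degeneratesTo_relabel (Fintype.equivOfCardEq hcard)
    (cell_not_degeneratesTo_of_sq_eq h hN (Fintype.equivOfCardEq hcard))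

end Rungs

end Summit.MatrixMultiplication.MatrixMultiplication.Theorems.OutsiderSandwichDegenerationBridge

end
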